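import Mathlib
import HarnessLib
import Summits.ValiantsHypothesis.ValiantsHypothesis.Theses.MonotoneRestoration
import Literature.Computability.AlgebraicComplexity.ArithCircuit
import Literature.Computability.AlgebraicComplexity.ArithCircuitProofs
import Literature.Computability.AlgebraicComplexity.MonotoneStructure
import Literature.Computability.AlgebraicComplexity.PermanentIrreducible
import Literature.ModelTheory.FiniteModelTheory.CkEquiv
import Summits.ValiantsHypothesis.ValiantsHypothesis.Theorems.MonotoneRestorationMonotoneRestorationQPCosetCount
import Summits.ValiantsHypothesis.ValiantsHypothesis.Theorems.MonotoneRestorationMonotoneRestorationQPSymmetricLB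
import Summits.ValiantsHypothesis.ValiantsHypothesis.Theorems.MonotoneRestorationMonotoneRestorationQPSupportSymmetrisation
import Summits.ValiantsHypothesis.ValiantsHypothesis.Theorems.MonotoneRestorationMonotoneRestorationQPSparseRegime
import Summits.ValiantsHypothesis.ValiantsHypothesis.Theorems.MonotoneRestorationMonotoneRestorationQPBeta
import Literature.Computability.AlgebraicComplexity.SymmetricArithCircuit
import Literature.Computability.AlgebraicComplexity.DawarWilsenach2025Proofs
import Literature.GroupTheory.PermutationGroups.SmallIndexSubgroups
import Summits.ValiantsHypothesis.ValiantsHypothesis.Theorems.MonotoneRestorationQP.Negative.LoadBearing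
import Summits.ValiantsHypothesis.ValiantsHypothesis.Theorems.MonotoneRestorationMonotoneRestorationQPPermSupportCount

/-! TTRL-lite variant V18946 of stmt-ValiantsHypothesis-15886 -/

-- `Summit.ValiantsHypothesis.ValiantsHypothesis.…` is the tree's mandated single-conjunct layout
-- (Sub = Summit), so the duplicated namespace component is intended.
set_option linter.dupNamespace false

namespace Summit.ValiantsHypothesis.ValiantsHypothesis.Theorems

open Summit.ValiantsHypothesis.ValiantsHypothesis.Theses.MonotoneRestoration
open Literature.Computability.AlgebraicComplexity

/-- TTRL-lite variant V18946 (`generalise`: the ADDITIVE analogue of part 2 of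
`stub_mulGate_children_extend`, with `p + q` in place of `p * q`) is FALSE.
Witness: `n = 1`, `p = q = f = X (0,0)`, `m = m' = Finsupp.single (0,0) 1`; the sum
`p + q = X (0,0) + X (0,0)` is nonzero and its support lies in that of `X (0,0)`, so it extends into
`f` with `μ = 0`, but `m + m' + μ` has exponent `≥ 2` at `(0,0)` while the unique monomial of `f`
has exponent `1` there.  Pins that the gate label `mul` is load-bearing for the cross-term
conclusion: for an add gate only the per-child inclusion (part 1) survives. -/
theorem stub_mulGate_children_extend_var18946_false :
    ¬ (∀ (n : ℕ) (p q f : MvPolynomial (Fin n × Fin n) NNReal), p + q ≠ 0 →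
        (∃ μ : (Fin n × Fin n) →₀ ℕ, ∀ m ∈ (p + q).support, m + μ ∈ f.support) →
        ∀ m ∈ p.support, ∀ m' ∈ q.support,
          ∃ μ : (Fin n × Fin n) →₀ ℕ, m + m' + μ ∈ f.support) := by
  classical
  intro h
  have hX : (Finsupp.single ((0 : Fin 1), (0 : Fin 1)) 1 : Fin 1 × Fin 1 →₀ ℕ) ∈
      (MvPolynomial.X ((0 : Fin 1), (0 : Fin 1)) : MvPolynomial (Fin 1 × Fin 1) NNReal).support := by
    rw [MvPolynomial.support_X]
    exact Finset.mem_singleton_self _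
  have hne : (MvPolynomial.X ((0 : Fin 1), (0 : Fin 1)) : MvPolynomial (Fin 1 × Fin 1) NNReal) +
      MvPolynomial.X ((0 : Fin 1), (0 : Fin 1)) ≠ 0 := by
    intro h0
    have h1 := congrArg
      (MvPolynomial.coeff (Finsupp.single ((0 : Fin 1), (0 : Fin 1)) 1)) h0
    simp only [MvPolynomial.coeff_add, MvPolynomial.coeff_X, MvPolynomial.coeff_zero] at h1
    norm_num at h1
  have hext : ∃ μ : (Fin 1 × Fin 1) →₀ ℕ,
      ∀ m ∈ ((MvPolynomial.X ((0 : Fin 1), (0 : Fin 1)) : MvPolynomial (Fin 1 × Fin 1) NNReal) +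
          MvPolynomial.X ((0 : Fin 1), (0 : Fin 1))).support,
        m + μ ∈ (MvPolynomial.X ((0 : Fin 1), (0 : Fin 1)) :
          MvPolynomial (Fin 1 × Fin 1) NNReal).support := by
    refine ⟨0, fun m hm => ?_⟩
    rw [add_zero]
    rcases Finset.mem_union.1 (MvPolynomial.support_add hm) with hm' | hm'
    · exact hm'
    · exact hm'
  obtain ⟨μ, hμ⟩ := h 1 (MvPolynomial.X ((0 : Fin 1), (0 : Fin 1)))
    (MvPolynomial.X ((0 : Fin 1), (0 : Fin 1)))
    (MvPolynomial.X ((0 : Fin 1), (0 : Fin 1))) hne hext _ hX _ hX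
  rw [MvPolynomial.support_X, Finset.mem_singleton] at hμ
  have h2 := congrArg (fun g : Fin 1 × Fin 1 →₀ ℕ => g ((0 : Fin 1), (0 : Fin 1))) hμ
  simp only [Finsupp.add_apply, Finsupp.single_eq_same] at h2
  omega

end Summit.ValiantsHypothesis.ValiantsHypothesis.Theorems
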